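import Summits.BirchSwinnertonDyer.BirchSwinnertonDyer.Theorems.PrintCf2SplitBadTwoUpperBaseLiftLayers
import HarnessLib

/-!
# Crux `PrintCf2.SplitBadTwoRankOneOfFacts` (stmt-BirchSwinnertonDyer-20368), S3N-FACTFREE road, the (SUR_U)/(LS↑) socket made
# REPRESENTATIVE-INDEPENDENT: targets at ANY system of representatives of the places `D_w \ Γ_K / U` (e.g. Mackey orbit representatives)

Cell `bsd-print-cf2`, EXTRA WIDTH seat `bsd-line-cf2-p1-w4` g12 (prover-bsd-line-cf2-p1-w4-g12-0); `--supports stmt-BirchSwinnertonDyer-20368`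
(helper, Theses-free). HONEST FRAMING: nothing here closes the crux or a registered stub; BSD is not proved by any of this; no summit statement
is proved by this seat. No definition, no named fact, no `sorry`.

WHY. The local-surjectivity socket of this seat's chain — (LS↑) of p698230 `baseLift_unr₂_of_locSurj` at `U = ker κ₂` and (LSₙ)/(SUR_U) of p700059
`locSurj_of_layers` at `U = κ₂.layerSubgroup n` — asks the supplier to hit targets at the CANONICAL representatives `q.out` of the double cosets
`q ∈ D_w \ Γ_K / U` (the places of `K̄^U` above `w`). The supplier (-w5 g7's Shapiro–Mackey reading of Poitou–Tate, `R2-BRICKS-w5g7.md` §2) naturally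
produces its local components at its OWN orbit representatives `g_i`. THIS FILE shows the socket does not care: for a closed normal `U` and ANY section
`s w : (D_w \ Γ_K / U) → Γ_K` of the double-coset projection, the statement with targets at `s w q` implies the statement with targets at `q.out`
(and is implied by it, by symmetry of the argument — only the useful direction is recorded). Mechanism: `q.out = d · (s w q) · u` with `d ∈ D_w`,
`u ∈ U` (`DoubleCoset.eq`); `conj_u` is trivial on `H¹(U, M)`; localisation at `D_w` intertwines `conj_d` on `H¹(U, M)` with `conj_d` on
`H¹(U ∩ D_w, M)` (p697961 `resH1Hom_decompInToH_comp_conjH1`), which preserves the classes vanishing on `U ∩ I_w` (p700059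
`resOfLe_conjH1_decompIn_eq_zero`); so asking for the targets `conj_{d⁻¹}(τ w q)` at `s w q` yields `τ w q` at `q.out`.
* **`locSurj_of_locSurj_section`** — (SUR_U) with targets at the representatives `s` ⟹ (SUR_U) with targets at `q.out` (any closed normal `U`,
  any discrete `M`, any side predicate on the places carried verbatim);
* **`locSurj_of_layers_section`** — p700059 `locSurj_of_layers` with the layer hypotheses (LSₙ) stated at arbitrary representatives `s n w`.
presearch: none needed (bookkeeping); pattern = the transport step of p700059. No new fact. beyond-print theorem: no.

References: [GreenbergVatsal2000] §2 Prop. 2.1 (pp. 17–21); [NeukirchSchmidtWingberg2008] I.§5; [SerreGaloisCohomology1997] I §2.5.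
-/

noncomputable section

open scoped Classical

set_option linter.dupNamespace false
set_option autoImplicit false

open NumberField IsDedekindDomain Field
open Literature.NumberTheory.EllipticCurves Literature.NumberTheory.EllipticCurves.GreenbergSelmer
open Literature.NumberTheory.EllipticCurves.GreenbergVatsal2000
open Literature.NumberTheory.GaloisRepresentations
open Summit.BirchSwinnertonDyer.Rank1Residual.X11b

namespace Summit.BirchSwinnertonDyer.BirchSwinnertonDyer.Theorems.PrintCf2.UpperBaseLift

section Section

variable {K : Type} [Field K] [NumberField K] {p : ℕ} (U : Subgroup (absoluteGaloisGroup K)) [U.Normal]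
  (M : Type) [AddCommGroup M] [DistribMulAction (absoluteGaloisGroup K) M] [TopologicalSpace M] [DiscreteTopology M]
  {vbar : HeightOneSpectrum (𝓞 K)}

/-- **The local-surjectivity socket is independent of the representatives.** Let `U ⊴ Γ_K` and let `s w` be ANY section of the projection
`Γ_K → D_w \ Γ_K / U` at every place `w`. If for every finite `T` (places `w ∤ p` or `w = v̄`) and every family of targets there is `z ∈ H¹(U, M)`
hitting the targets at the representatives `s w q` modulo classes vanishing on `U ∩ I_w` and unramified at all other relevant places, then the same
holds with the canonical representatives `q.out` (the `hLS`/`hLSn` shape of p698230 / p700059). [cite: GreenbergVatsal2000, §2 Prop. 2.1]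
[cite: NeukirchSchmidtWingberg2008, I.§5] -/
theorem locSurj_of_locSurj_section
    (s : (w : HeightOneSpectrum (𝓞 K)) →
      DoubleCoset.Quotient (decomp (K := K) w : Set (absoluteGaloisGroup K)) (U : Set (absoluteGaloisGroup K)) → absoluteGaloisGroup K)
    (hs : ∀ (w : HeightOneSpectrum (𝓞 K))
      (q : DoubleCoset.Quotient (decomp (K := K) w : Set (absoluteGaloisGroup K)) (U : Set (absoluteGaloisGroup K))),
      DoubleCoset.mk (decomp (K := K) w) U (s w q) = q)
    (hLSs : ∀ (T : Finset (HeightOneSpectrum (𝓞 K))), (∀ w ∈ T, ((p : ℕ) : 𝓞 K) ∉ w.asIdeal ∨ w = vbar) →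
      ∀ τ : (w : HeightOneSpectrum (𝓞 K)) →
        DoubleCoset.Quotient (decomp (K := K) w : Set (absoluteGaloisGroup K)) (U : Set (absoluteGaloisGroup K)) → subgroupH1 (decompIn U w) M,
      ∃ z : subgroupH1 U M,
        (∀ w ∈ T, ∀ q : DoubleCoset.Quotient (decomp (K := K) w : Set (absoluteGaloisGroup K)) (U : Set (absoluteGaloisGroup K)),
          resOfLe M (inertiaIn_le_decompIn U w)
            (resH1Hom (decompInToH U w) (AddMonoidHom.id M) (fun _ _ ↦ rfl) (conjH1 U M (s w q) z) - τ w q) = 0) ∧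
        (∀ w : HeightOneSpectrum (𝓞 K), w ∉ T → (((p : ℕ) : 𝓞 K) ∉ w.asIdeal ∨ w = vbar) →
          ∀ σ : absoluteGaloisGroup K, conjH1 U M σ z ∈ unramifiedKer U M w)) :
    ∀ (T : Finset (HeightOneSpectrum (𝓞 K))), (∀ w ∈ T, ((p : ℕ) : 𝓞 K) ∉ w.asIdeal ∨ w = vbar) →
      ∀ τ : (w : HeightOneSpectrum (𝓞 K)) →
        DoubleCoset.Quotient (decomp (K := K) w : Set (absoluteGaloisGroup K)) (U : Set (absoluteGaloisGroup K)) → subgroupH1 (decompIn U w) M,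
      ∃ z : subgroupH1 U M,
        (∀ w ∈ T, ∀ q : DoubleCoset.Quotient (decomp (K := K) w : Set (absoluteGaloisGroup K)) (U : Set (absoluteGaloisGroup K)),
          resOfLe M (inertiaIn_le_decompIn U w)
            (resH1Hom (decompInToH U w) (AddMonoidHom.id M) (fun _ _ ↦ rfl) (conjH1 U M q.out z) - τ w q) = 0) ∧
        (∀ w : HeightOneSpectrum (𝓞 K), w ∉ T → (((p : ℕ) : 𝓞 K) ∉ w.asIdeal ∨ w = vbar) →
          ∀ σ : absoluteGaloisGroup K, conjH1 U M σ z ∈ unramifiedKer U M w) := by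
  intro T hT τ
  haveI hUn : ∀ w : HeightOneSpectrum (𝓞 K), (decompIn U w).Normal := fun w ↦ Rank1Residual.SelmerDual.decompIn_normal _ w
  -- `q.out = d · (s w q) · u`, `d ∈ D_w`, `u ∈ U`
  have hdu : ∀ (w : HeightOneSpectrum (𝓞 K))
      (q : DoubleCoset.Quotient (decomp (K := K) w : Set (absoluteGaloisGroup K)) (U : Set (absoluteGaloisGroup K))),
      ∃ d : decomp (K := K) w, ∃ u : absoluteGaloisGroup K, u ∈ U ∧ q.out = (d : absoluteGaloisGroup K) * s w q * u := by
    intro w q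
    obtain ⟨d, hd, u, hu, he⟩ := (DoubleCoset.eq (decomp (K := K) w) U (s w q) q.out).1 (by rw [hs, DoubleCoset.out_eq'])
    exact ⟨⟨d, hd⟩, u, hu, he⟩
  choose dOf uOf huOf hduOf using hdu
  -- the transported targets at the representatives `s`
  obtain ⟨z, hzT, hz0⟩ := hLSs T hT fun w q ↦ conjH1 (decompIn U w) M (dOf w q)⁻¹ (τ w q)
  refine ⟨z, fun w hwT q ↦ ?_, hz0⟩
  have hmatch := hzT w hwT q
  -- `conj_{q.out} z = conj_d (conj_{s q} z)`
  have hconj : conjH1 U M q.out z = conjH1 U M (dOf w q : absoluteGaloisGroup K) (conjH1 U M (s w q) z) := by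
    rw [hduOf w q, Literature.NumberTheory.EllipticCurves.conjH1_mul_holds U M, AddMonoidHom.comp_apply,
      Literature.NumberTheory.EllipticCurves.conjH1_mul_holds U M, AddMonoidHom.comp_apply,
      Literature.NumberTheory.EllipticCurves.conjH1_of_mem_holds U M (huOf w q), AddMonoidHom.id_apply]
  have hDconj : ∀ y : subgroupH1 U M, resH1Hom (decompInToH U w) (AddMonoidHom.id M) (fun _ _ ↦ rfl) (conjH1 U M (dOf w q : absoluteGaloisGroup K) y) =
      conjH1 (decompIn U w) M (dOf w q) (resH1Hom (decompInToH U w) (AddMonoidHom.id M) (fun _ _ ↦ rfl) y) := fun y ↦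
    congrArg (fun f ↦ f y) (resH1Hom_decompInToH_comp_conjH1 U M w (dOf w q))
  -- the defect at `s w q`
  obtain ⟨u, hu0, hu⟩ : ∃ u : subgroupH1 (decompIn U w) M, resOfLe M (inertiaIn_le_decompIn U w) u = 0 ∧
      resH1Hom (decompInToH U w) (AddMonoidHom.id M) (fun _ _ ↦ rfl) (conjH1 U M (s w q) z) =
        conjH1 (decompIn U w) M (dOf w q)⁻¹ (τ w q) + u :=
    ⟨resH1Hom (decompInToH U w) (AddMonoidHom.id M) (fun _ _ ↦ rfl) (conjH1 U M (s w q) z) - conjH1 (decompIn U w) M (dOf w q)⁻¹ (τ w q),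
      hmatch, by abel⟩
  have hkey : resH1Hom (decompInToH U w) (AddMonoidHom.id M) (fun _ _ ↦ rfl) (conjH1 U M q.out z) - τ w q =
      conjH1 (decompIn U w) M (dOf w q) u := by
    rw [hconj, hDconj, hu, map_add, ← AddMonoidHom.comp_apply (conjH1 _ M (dOf w q)) (conjH1 _ M (dOf w q)⁻¹),
      ← Literature.NumberTheory.EllipticCurves.conjH1_mul_holds (decompIn U w) M, mul_inv_cancel,
      Literature.NumberTheory.EllipticCurves.conjH1_one_holds (decompIn U w) M, AddMonoidHom.id_apply]
    abel
  rw [hkey]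
  exact resOfLe_conjH1_decompIn_eq_zero (dOf w q) hu0

end Section

/-! ## The limit step with layer hypotheses at arbitrary representatives -/

section Layers

variable {K : Type} [Field K] [NumberField K] {p : ℕ} [Fact p.Prime] (κ : ZpExtension K p)
  (M : Type) [AddCommGroup M] [DistribMulAction (absoluteGaloisGroup K) M] [TopologicalSpace M] [DiscreteTopology M]
  {vbar : HeightOneSpectrum (𝓞 K)}

/-- **`locSurj_of_layers` (p700059) with the layer hypotheses (LSₙ) stated at ARBITRARY representatives `s n w` of the places of `K_n` above `w`**
(e.g. the Mackey orbit representatives of the supplier's Shapiro reading). [cite: GreenbergVatsal2000, §2 Prop. 2.1 (pp. 17–21)]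
[cite: SerreGaloisCohomology1997, I §2.2 Prop. 8] -/
theorem locSurj_of_layers_section
    (hstab : ∀ m : M, IsOpen (MulAction.stabilizer (absoluteGaloisGroup K) m : Set (absoluteGaloisGroup K)))
    (hD : ∀ w : HeightOneSpectrum (𝓞 K), (((p : ℕ) : 𝓞 K) ∉ w.asIdeal ∨ w = vbar) → ¬ decomp (K := K) w ≤ κ.kerSubgroup) (n₁ : ℕ)
    (s : (n : ℕ) → (w : HeightOneSpectrum (𝓞 K)) →
      DoubleCoset.Quotient (decomp (K := K) w : Set (absoluteGaloisGroup K)) (κ.layerSubgroup n : Set (absoluteGaloisGroup K)) →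
        absoluteGaloisGroup K)
    (hs : ∀ (n : ℕ) (w : HeightOneSpectrum (𝓞 K))
      (q : DoubleCoset.Quotient (decomp (K := K) w : Set (absoluteGaloisGroup K)) (κ.layerSubgroup n : Set (absoluteGaloisGroup K))),
      DoubleCoset.mk (decomp (K := K) w) (κ.layerSubgroup n) (s n w q) = q)
    (hLSn : ∀ n : ℕ, n₁ ≤ n → ∀ (T : Finset (HeightOneSpectrum (𝓞 K))), (∀ w ∈ T, ((p : ℕ) : 𝓞 K) ∉ w.asIdeal ∨ w = vbar) →
      ∀ τ' : (w : HeightOneSpectrum (𝓞 K)) →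
        DoubleCoset.Quotient (decomp (K := K) w : Set (absoluteGaloisGroup K)) (κ.layerSubgroup n : Set (absoluteGaloisGroup K)) →
          subgroupH1 (decompIn (κ.layerSubgroup n) w) M,
      ∃ z' : subgroupH1 (κ.layerSubgroup n) M,
        (∀ w ∈ T, ∀ Q : DoubleCoset.Quotient (decomp (K := K) w : Set (absoluteGaloisGroup K)) (κ.layerSubgroup n : Set (absoluteGaloisGroup K)),
          resOfLe M (inertiaIn_le_decompIn (κ.layerSubgroup n) w)
            (resH1Hom (decompInToH (κ.layerSubgroup n) w) (AddMonoidHom.id M) (fun _ _ ↦ rfl) (conjH1 (κ.layerSubgroup n) M (s n w Q) z') -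
              τ' w Q) = 0) ∧
        (∀ w : HeightOneSpectrum (𝓞 K), w ∉ T → (((p : ℕ) : 𝓞 K) ∉ w.asIdeal ∨ w = vbar) →
          ∀ σ : absoluteGaloisGroup K, conjH1 (κ.layerSubgroup n) M σ z' ∈ unramifiedKer (κ.layerSubgroup n) M w)) :
    ∀ (T : Finset (HeightOneSpectrum (𝓞 K))), (∀ w ∈ T, ((p : ℕ) : 𝓞 K) ∉ w.asIdeal ∨ w = vbar) →
      ∀ τ : (w : HeightOneSpectrum (𝓞 K)) →
        DoubleCoset.Quotient (decomp (K := K) w : Set (absoluteGaloisGroup K)) (κ.kerSubgroup : Set (absoluteGaloisGroup K)) →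
          subgroupH1 (decompIn κ.kerSubgroup w) M,
      ∃ z : subgroupH1 κ.kerSubgroup M,
        (∀ w ∈ T, ∀ q : DoubleCoset.Quotient (decomp (K := K) w : Set (absoluteGaloisGroup K)) (κ.kerSubgroup : Set (absoluteGaloisGroup K)),
          resOfLe M (inertiaIn_le_decompIn κ.kerSubgroup w)
            (resH1Hom (decompInToH κ.kerSubgroup w) (AddMonoidHom.id M) (fun _ _ ↦ rfl) (conjH1 κ.kerSubgroup M q.out z) - τ w q) = 0) ∧
        (∀ w : HeightOneSpectrum (𝓞 K), w ∉ T → (((p : ℕ) : 𝓞 K) ∉ w.asIdeal ∨ w = vbar) →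
          ∀ σ : absoluteGaloisGroup K, conjH1 κ.kerSubgroup M σ z ∈ unramifiedKer κ.kerSubgroup M w) :=
  locSurj_of_layers κ M hstab hD n₁ fun n hn ↦
    locSurj_of_locSurj_section (p := p) (κ.layerSubgroup n) M (s n) (hs n) (hLSn n hn)

end Layers

end Summit.BirchSwinnertonDyer.BirchSwinnertonDyer.Theorems.PrintCf2.UpperBaseLift

end
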